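import Summits.CriticalPhenomena.CardyFormulaZ2.Theses.CardyWickAnisotropy
import Literature.Probability.Percolation.ProdBernoulliRusso
import Literature.Probability.Percolation.PlanarDuality
import Literature.Probability.Percolation.StarTriangleIsoradial
import Literature.Probability.LatticeModels.IsoradialPercolationProofs
import HarnessLib

/-!
# Route CardyWickAnisotropy — the real-axis dictionary (item `RealAxisDictionary`)

Support item `stmt-CriticalPhenomena-14494` of route `CardyWickAnisotropy`
(`Summits/CriticalPhenomena/CardyFormulaZ2/Theses/CardyWickAnisotropy.lean`): on the real
diameter `(0, 1)` of the disc `D = {|2p - 1| < 1}` the complex-anisotropy crossing amplitude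
`V_n(p) = Σ_{ω ⊆ E(R_n)} 𝟙[ω ∈ LR(R_n)] ∏_e (w_p(e) if e ∈ ω else 1 - w_p(e))` of the box
`R_n = [0, n+1] × [0, n]` (weights `w_p = p` on horizontal and `1 - p` on vertical lattice
edges), evaluated at the canonical isoradial weight `p = criticalWeight (α/2)`, `α ∈ (0, π)`,
is the probability of the left-right crossing `lrCrossing (n+1) n` under the product Bernoulli
law `prodBernoulli (P α)` with parameter `criticalWeightI (α/2)` on horizontal edges,
`criticalWeightI ((π - α)/2)` on vertical edges of `ℤ²`, and `0` off the edge set.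

Proof (finite-dimensional marginal of the product measure): the crossing event is determined
by the pairs of sites of the box (`PlanarDuality.determinedBy_openCrossing`), so its
probability is the cylinder sum over the subsets of those pairs
(`RussoPath.prodBernoulli_real_eq_sum_powerset`); pairs of sites of the box that are not
lattice edges carry parameter `0` and drop out of the cylinder sum
(`sum_powerset_cylinder_eq_of_subset`), leaving the sum over the subsets of the lattice edges of
the box, i.e. `V_n`; the weights agree by `coe_criticalWeightI_holds` and the complement rule
`criticalWeight ((π - α)/2) = 1 - criticalWeight (α/2)` (`StarTriangle.criticalWeight_pi_div_two_sub`,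
Grimmett–Manolescu 2014, (2.3): `p_θ + p_{π-θ} = 1`).
-/

namespace Summit.CriticalPhenomena.CardyFormulaZ2.Theorems

open MeasureTheory Finset
open Literature.Probability.LatticeModels Literature.Probability.Percolation
open Summit.CriticalPhenomena.CardyFormulaZ2.Theses.CardyWickAnisotropy

open scoped Classical in
/-- Shrinking the index set of a cylinder sum: if `K ⊆ F` and the parameters `p` vanish on
`F \ K`, then the cylinder sum of an event `B` over the subsets of `F` equals the cylinder sum
over the subsets of `K` (a subset of `F` meeting `F \ K` has a factor `p_i = 0`; for `S ⊆ K`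
the extra factors over `F \ K` are `1 - 0 = 1`). -/
theorem sum_powerset_cylinder_eq_of_subset {ι : Type*} [DecidableEq ι] (B : Set (Set ι))
    {K F : Finset ι} (hKF : K ⊆ F) (p : ι → unitInterval) (hp : ∀ i ∈ F, i ∉ K → p i = 0) :
    (∑ S ∈ F.powerset, if (↑S : Set ι) ∈ B then
        ∏ i ∈ F, (if i ∈ S then (p i : ℝ) else 1 - (p i : ℝ)) else 0) =
      ∑ S ∈ K.powerset, if (↑S : Set ι) ∈ B then
        ∏ i ∈ K, (if i ∈ S then (p i : ℝ) else 1 - (p i : ℝ)) else 0 := by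
  have h1 : ∀ S ∈ K.powerset, (∏ i ∈ K, (if i ∈ S then (p i : ℝ) else 1 - (p i : ℝ))) =
      ∏ i ∈ F, (if i ∈ S then (p i : ℝ) else 1 - (p i : ℝ)) := by
    intro S hS
    rw [Finset.mem_powerset] at hS
    refine Finset.prod_subset hKF fun i hiF hiK => ?_
    have hiS : i ∉ S := fun h => hiK (hS h)
    rw [if_neg hiS, hp i hiF hiK]
    simp
  symm
  calc (∑ S ∈ K.powerset, if (↑S : Set ι) ∈ B then
          ∏ i ∈ K, (if i ∈ S then (p i : ℝ) else 1 - (p i : ℝ)) else 0)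
      = ∑ S ∈ K.powerset, if (↑S : Set ι) ∈ B then
          ∏ i ∈ F, (if i ∈ S then (p i : ℝ) else 1 - (p i : ℝ)) else 0 :=
        Finset.sum_congr rfl fun S hS => by rw [h1 S hS]
    _ = ∑ S ∈ F.powerset, if (↑S : Set ι) ∈ B then
          ∏ i ∈ F, (if i ∈ S then (p i : ℝ) else 1 - (p i : ℝ)) else 0 := by
        refine Finset.sum_subset (Finset.powerset_mono.2 hKF) fun S hSF hSK => ?_
        rw [Finset.mem_powerset] at hSF hSK
        obtain ⟨i, hiS, hiK⟩ := Finset.not_subset.1 hSK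
        have hzero : (∏ i ∈ F, (if i ∈ S then (p i : ℝ) else 1 - (p i : ℝ))) = 0 :=
          Finset.prod_eq_zero (hSF hiS) (by rw [if_pos hiS, hp i (hSF hiS) hiK]; rfl)
        rw [hzero, ite_self]

open scoped Classical in
/-- **Finite-dimensional marginal of `prodBernoulli` on a smaller index set.** If the event `B`
is determined by the finite set `F`, `K ⊆ F`, and the parameters vanish on `F \ K`, then
`P_p(B) = Σ_{S ⊆ K} 𝟙[S ∈ B] ∏_{i ∈ K} (p_i if i ∈ S else 1 - p_i)` (the coordinates in
`F \ K` are almost surely closed). -/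
theorem prodBernoulli_real_eq_sum_powerset_of_subset {ι : Type*} [DecidableEq ι]
    {B : Set (Set ι)} {K F : Finset ι} (hB : DeterminedBy B (↑F : Set ι)) (hKF : K ⊆ F)
    (p : ι → unitInterval) (hp : ∀ i ∈ F, i ∉ K → p i = 0) :
    (prodBernoulli p).real B =
      ∑ S ∈ K.powerset, if (↑S : Set ι) ∈ B then
        ∏ i ∈ K, (if i ∈ S then (p i : ℝ) else 1 - (p i : ℝ)) else 0 := by
  rw [RussoPath.prodBernoulli_real_eq_sum_powerset hB p]
  exact sum_powerset_cylinder_eq_of_subset B hKF p hp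

/-- The canonical weights on the critical line: for `α ∈ (0, π)`,
`criticalWeight ((π - α)/2) = 1 - criticalWeight (α/2)` (Grimmett–Manolescu 2014, (2.3)). -/
theorem criticalWeight_pi_sub_div_two {α : ℝ} (hα : α ∈ Set.Ioo (0 : ℝ) Real.pi) :
    criticalWeight ((Real.pi - α) / 2) = 1 - criticalWeight (α / 2) := by
  have h : (Real.pi - α) / 2 = Real.pi / 2 - α / 2 := by ring
  rw [h]
  exact StarTriangle.criticalWeight_pi_div_two_sub
    ⟨by linarith [hα.1], by linarith [hα.2]⟩

open scoped Classical in
/-- **Item `RealAxisDictionary`** (support of route `CardyWickAnisotropy`): for `α ∈ (0, π)`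
and every `n`, the crossing amplitude `V_n` of the box `[0, n+1] × [0, n]` at the real coupling
`p = criticalWeight (α/2)` is the `prodBernoulli (P α)`-probability of `lrCrossing (n+1) n`. -/
theorem realAxisDictionary_proof : RealAxisDictionary := by
  unfold RealAxisDictionary
  dsimp only
  intro α hα n
  set K : Finset (Sym2 (Site 2)) := ((rectangle (n + 1) n ×ˢ rectangle (n + 1) n).filter
      (fun xy ↦ (zdGraph 2).Adj xy.1 xy.2)).image (fun xy ↦ s(xy.1, xy.2)) with hK
  set Pα : Sym2 (Site 2) → unitInterval := fun e ↦ if e ∈ (zdGraph 2).edgeSet then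
      (if (∃ x y : Site 2, e = s(x, y) ∧ x 1 = y 1) then criticalWeightI (α / 2)
        else criticalWeightI ((Real.pi - α) / 2)) else 0 with hPα
  -- the lattice edges of the box are pairs of sites of the box
  have hKF : K ⊆ (rectangle (n + 1) n).sym2 := by
    intro e he
    rw [hK, Finset.mem_image] at he
    obtain ⟨xy, hxy, rfl⟩ := he
    rw [Finset.mem_filter, Finset.mem_product] at hxy
    exact Finset.mk_mem_sym2_iff.2 ⟨hxy.1.1, hxy.1.2⟩
  -- they are lattice edges
  have hKE : ∀ e ∈ K, e ∈ (zdGraph 2).edgeSet := by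
    intro e he
    rw [hK, Finset.mem_image] at he
    obtain ⟨xy, hxy, rfl⟩ := he
    rw [Finset.mem_filter] at hxy
    exact (SimpleGraph.mem_edgeSet _).2 hxy.2
  -- the other pairs of sites of the box carry parameter `0`
  have hp0 : ∀ e ∈ (rectangle (n + 1) n).sym2, e ∉ K → Pα e = 0 := by
    intro e he heK
    have hne : e ∉ (zdGraph 2).edgeSet := by
      intro hedge
      apply heK
      induction e using Sym2.ind with
      | h x y =>
        rw [hK, Finset.mem_image]
        refine ⟨(x, y), ?_, rfl⟩
        rw [Finset.mem_filter, Finset.mem_product]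
        exact ⟨Finset.mk_mem_sym2_iff.1 he, (SimpleGraph.mem_edgeSet _).1 hedge⟩
    rw [hPα]
    beta_reduce
    rw [if_neg hne]
  -- the crossing event is determined by the pairs of sites of the box
  have hdet : DeterminedBy (lrCrossing (n + 1) n)
      (↑(rectangle (n + 1) n).sym2 : Set (Sym2 (Site 2))) :=
    PlanarDuality.determinedBy_openCrossing (rectangle (n + 1) n) _ _
  -- the weights on the lattice edges of the box
  have hw : ∀ e ∈ K, (Pα e : ℝ) =
      if (∃ x y : Site 2, e = s(x, y) ∧ x 1 = y 1) then criticalWeight (α / 2)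
        else 1 - criticalWeight (α / 2) := by
    intro e he
    rw [hPα]
    beta_reduce
    rw [if_pos (hKE e he)]
    split_ifs with hh
    · exact coe_criticalWeightI_holds ⟨by linarith [hα.1], by linarith [hα.2]⟩
    · rw [coe_criticalWeightI_holds ⟨by linarith [hα.2], by linarith [hα.1]⟩]
      exact criticalWeight_pi_sub_div_two hα
  rw [prodBernoulli_real_eq_sum_powerset_of_subset hdet hKF Pα hp0, Complex.ofReal_sum]
  refine Finset.sum_congr rfl fun S _ => ?_
  split_ifs with hLR
  · rw [Complex.ofReal_prod]
    refine Finset.prod_congr rfl fun e he => ?_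
    rw [apply_ite ((↑) : ℝ → ℂ), hw e he]
    split_ifs <;> push_cast <;> ring
  · simp

end Summit.CriticalPhenomena.CardyFormulaZ2.Theorems
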